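import Summits.BirchSwinnertonDyer.BirchSwinnertonDyer.Theorems.AlignedTransportAtTwoMainConjectureOfRankZeroBSDAtTwoSelmerLayerMuDoorDescent
import Summits.BirchSwinnertonDyer.BirchSwinnertonDyer.Theorems.AlignedTransportAtTwoMainConjectureOfRankZeroBSDAtTwoSelmerLayerMuDoorTowerCurrency
import Summits.BirchSwinnertonDyer.BirchSwinnertonDyer.Theorems.AlignedTransportAtTwoMainConjectureOfRankZeroBSDAtTwoCubicClassNumberParityOfLValue
import Literature.NumberTheory.EllipticCurves.SelmerCorankControlRatProofs
import HarnessLib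

/-!
# Route `AlignedTransportAtTwo`, crux C2 `MainConjectureOfRankZeroBSDAtTwo` (stmt-BirchSwinnertonDyer-22298):
# THE BASE-LAYER `μ`-DOOR IN DESCENT CURRENCY — `#Sel^(2)(E/ℚ_k) · #ker g_k · 2 < #Sel^(2)(E/ℚ) · 2^{2^k}`, and on the `BSD₂` cell
# `#Sel^(2)(E/ℚ) = #Ш(E/ℚ)[2]`: the base `2`-descent a seed ALREADY HAS (its `#Ш_an`) feeds the door — one extra bit when `2 ∣ #Ш_an`

HONEST FRAMING (cell `bsd-f1-sign2`, WIDTH-5 attached prover seat `bsd-line-att-p5` gen 44 on line `birth` of the lead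
`bsd-line-att-p2`; `--supports` stmt-BirchSwinnertonDyer-22298, closes nothing; BSD is NOT proved by any of this; the crux C2,
its verdict «blocked-on `Rank1Residual.GreenbergMuConjectureIrreducible`» and every registered stub are untouched). THEOREMS ONLY —
no `def`, no instance, no named fact, no `sorry`. PLACEMENT: COROLLARY-OF-TREE (sequel of `…SelmerLayerMuDoorDescent`).

The pair of layers `(j, k) = (0, k)` of the Selmer rank-jump `μ`-door has the HONEST `2`-descent over `ℚ` on its lower side:
`W.selmerLayer κ 0 ≃ Sel_{2^∞}(E/ℚ)` (tree `nonempty_selmerLayer_zero_addEquiv`), `#Sel^(2)(E/ℚ) = #Sel_{2^∞}(E/ℚ)[2]` on the cell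
(Literature `natCard_selmerGroup_two_eq_of_forall_not_hasRationalTwoTorsionX`), and in rank `0` — every seed: `r_an = 0`, `BSD₂(W)` —
`#Sel^(2)(E/ℚ) = #Ш(E/ℚ)[2]`, a number the seed's BSD data already certify (`#Ш(E/ℚ)[2] ≥ 4` as soon as `2 ∣ #Ш_an(W)`, Cauchy +
Cassels–Tate, tree `four_le_natCard_sha_torsionBy_two_of_bsdp`). So:

* §0 `natCard_subtype_two_nsmul_selmerLayer_eq_natCard_selmerGroup` — the TOWER road's displayed layer counts
  `#{z ∈ W.selmerLayer κ n | 2z = 0}` ARE `#Sel^(2)(E_{ℚ_n}/ℚ_n)` on the cell.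
* §1 `natCard_torsionBy_selmerLayer_zero_two_eq` — `#(W.selmerLayer κ 0)[2] = #Sel_{2^∞}(E/ℚ)[2]` (any `W/ℚ`); on the cell
  `natCard_selmerGroup_two_eq_natCard_torsionBy_selmerLayer_zero` — `#Sel^(2)(E/ℚ) = #(W.selmerLayer κ 0)[2]`, and in rank `0`
  `natCard_torsionBy_selmerLayer_zero_two_eq_natCard_sha` — `= #Ш(E/ℚ)[2]`.
* §2 ★★★ `seedMuZero_of_descent_baseJump_two` — **`#Sel^(2)(E/ℚ_k) · #ker g_k · 2 < #Sel^(2)(E/ℚ) · 2^{2^k}` at ONE layer `k ≥ 1` ⟹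
  `X(W/ℚ_∞)` torsion, `μ₂ = 0`, `2^{λ} ≤ #Sel^(2)(E/ℚ_k) · #ker g_k`** (ONE `2`-descent over `ℚ_k` against the known one over `ℚ`);
  ★★★ `seedMuZero_of_descent_baseJump_sha_two` — on the rank-`0` cell the same with `#Ш(E/ℚ)[2]` for `#Sel^(2)(E/ℚ)`;
  ★★ `seedMuZero_of_descent_baseJump_of_shaAn_even` — with `BSD₂(W)` and `ord₂ #Ш_an(W) ≠ 0`:
  **`#Sel^(2)(E/ℚ_k) · #ker g_k < 2^{2^k + 1}` suffices** — one bit MORE than the one-layer door `… < 2^{2^k}` of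
  `…MuDoorDescent.seedMuZero_of_descent_oneLayer_two`, exactly on the seeds (`2 ∣ #Ш_an`: the `1727a1` / `2045b1`-type rows) where the
  `BSD₂` side of C2 has content at `2`. At `k = 2` (`ℚ(ζ₁₆)⁺`, degree `4`): `rk₂ Sel^(2)(E/ℚ(ζ₁₆)⁺) + log₂ #ker g_2 ≤ 4`.

What this does NOT do: run any descent, bound `#ker g_k` (TOWER road currency), prove T for any curve, touch the `μ`-conjecture.
References: J. H. Silverman, GTM 106 (2009), X.4.2 [SilvermanAEC2009]; R. Greenberg, LNM 1716 (1999), §1 p. 60 (`F_0 = F`), Conj. 1.11,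
§3 [GreenbergLNM1716]; J. W. S. Cassels, J. reine angew. Math. 211 (1962) (alternating pairing on Ш) [Cassels1962ArithmeticIV];
R. L. Miller, LMS J. Comput. Math. 14 (2011), Def. 1.1 (`BSD(E,p)`) [Miller2011LMS].
-/

set_option linter.dupNamespace false
set_option autoImplicit false

noncomputable section

open scoped Classical AddSubgroup

universe u

namespace Summit.BirchSwinnertonDyer.BirchSwinnertonDyer.Theorems.AlignedTransportAtTwoSelmerLayerMuDoorDescentBase

open WeierstrassCurve Literature.NumberTheory.EllipticCurves Literature.NumberTheory.EllipticCurves.Greenberg1999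
  Summit.BirchSwinnertonDyer.BirchSwinnertonDyer.Theorems.AlignedTransportAtTwoSelmerLayerMuDoor
  Summit.BirchSwinnertonDyer.BirchSwinnertonDyer.Theorems.AlignedTransportAtTwoSelmerLayerMuDoorDescent
  Summit.BirchSwinnertonDyer.BirchSwinnertonDyer.Theorems.AlignedTransportAtTwoCubicClassNumberParityOfLValue
  Summit.BirchSwinnertonDyer.BirchSwinnertonDyer.Theorems.AlignedTransportAtTwoSelmerLayerMuDoorTowerCurrency

variable (W : WeierstrassCurve ℚ) [W.IsElliptic] [W.IsGloballyMinimal]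

/-! ## §0 The TOWER road's currency is the descent currency -/

omit [W.IsGloballyMinimal] in
/-- **`#{z ∈ W.selmerLayer κ n | 2z = 0} = #Sel^(2)(E_{ℚ_n}/ℚ_n)`** on the cell (no rational `2`-torsion abscissa): the kit-certified layer
counts displayed by this cell's TOWER road (att-p4's `Theorems/ByReductionTypeAtTwoTowerClass*.lean`, `KatoHalfPinch.towerGapAtTwo_of_layerSelmer_cert`:
`Nat.card {z : W.selmerLayer κ j // 2 • z = 0}`) ARE the orders of the `2`-Selmer groups of `2`-descents over the layer number fields
(g43's `natCard_subtype_nsmul_eq_natCard_torsionBy` + `natCard_selmerGroup_two_layer_eq`). [cite: SilvermanAEC2009, Thm. X.4.2 and §III.2]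
[cite: GreenbergLNM1716, §2–§3] -/
theorem natCard_subtype_two_nsmul_selmerLayer_eq_natCard_selmerGroup (ht : ∀ x : ℚ, ¬ HasRationalTwoTorsionX W x)
    (κ : ZpExtension ℚ 2) (n : ℕ) :
    Nat.card {z : W.selmerLayer κ n // 2 • z = 0} = Nat.card ((W.baseChange (κ.layer n)).selmerGroup 2) := by
  rw [natCard_subtype_nsmul_eq_natCard_torsionBy, natCard_selmerGroup_two_layer_eq W ht κ n, Nat.cast_ofNat]

/-! ## §1 The base layer: `#(W.selmerLayer κ 0)[2] = #Sel_{2^∞}(E/ℚ)[2] = #Sel^(2)(E/ℚ) = #Ш(E/ℚ)[2]` -/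

omit [W.IsElliptic] [W.IsGloballyMinimal] in
/-- **`#(W.selmerLayer κ 0)[2] = #Sel_{2^∞}(E/ℚ)[2]`** for every `W/ℚ` and every `ℤ₂`-extension `κ`: the `0`-th layer Selmer group
IS `Sel_{2^∞}(E/ℚ)` (tree `nonempty_selmerLayer_zero_addEquiv`, Greenberg's `F_0 = F`), and an isomorphism preserves `2`-torsion.
[cite: GreenbergLNM1716, §1 p. 60] -/
theorem natCard_torsionBy_selmerLayer_zero_two_eq (κ : ZpExtension ℚ 2) :
    Nat.card ((↥(W.selmerLayer κ 0))[(2 : ℤ)]) = Nat.card ((↥(W.selmerGroupPInfty 2))[(2 : ℤ)]) := by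
  obtain ⟨e⟩ := W.nonempty_selmerLayer_zero_addEquiv (κ := κ)
  exact Nat.card_congr (torsionByEquiv e 2).toEquiv

omit [W.IsGloballyMinimal] in
/-- ★ **`#Sel^(2)(E/ℚ) = #(W.selmerLayer κ 0)[2]`** for `W/ℚ` elliptic WITHOUT a rational `2`-torsion abscissa: the honest `2`-descent
over `ℚ` (tree `selmerGroup W 2`, Silverman X.4.2) counts the `2`-torsion of the `0`-th layer Selmer group exactly (`E(ℚ)[2] = 0`;
Literature `natCard_selmerGroup_two_eq_of_forall_not_hasRationalTwoTorsionX`). [cite: SilvermanAEC2009, Thm. X.4.2 and §III.2]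
[cite: GreenbergLNM1716, §1 p. 60, §2 pp. 62–63] -/
theorem natCard_selmerGroup_two_eq_natCard_torsionBy_selmerLayer_zero (ht : ∀ x : ℚ, ¬ HasRationalTwoTorsionX W x)
    (κ : ZpExtension ℚ 2) : Nat.card (W.selmerGroup 2) = Nat.card ((↥(W.selmerLayer κ 0))[(2 : ℤ)]) := by
  rw [natCard_torsionBy_selmerLayer_zero_two_eq W κ]
  exact W.natCard_selmerGroup_two_eq_of_forall_not_hasRationalTwoTorsionX ht

omit [W.IsGloballyMinimal] in
/-- **`#(W.selmerLayer κ 0)[2] = 2^{rank E(ℚ)} · #Ш(E/ℚ)[2]`** for every elliptic `W/ℚ` (Greenberg §2's sequence on `2`-torsion, tree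
`natCard_torsionBy_selmerGroupPInfty_eq`, at the `0`-th layer). [cite: GreenbergLNM1716, §1 p. 60, §2 pp. 62–63] -/
theorem natCard_torsionBy_selmerLayer_zero_two_eq_pow_rank_mul_sha (κ : ZpExtension ℚ 2) :
    Nat.card ((↥(W.selmerLayer κ 0))[(2 : ℤ)]) = 2 ^ W.mordellWeilRank * Nat.card ((↥W.sha)[(2 : ℤ)]) := by
  rw [natCard_torsionBy_selmerLayer_zero_two_eq W κ]
  exact_mod_cast W.natCard_torsionBy_selmerGroupPInfty_eq 2

omit [W.IsGloballyMinimal] in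
/-- **`#(W.selmerLayer κ 0)[2] = #Ш(E/ℚ)[2]` in rank `0`** (every seed of the cell: `r_an = 0` and `BSD₂` give `rank E(ℚ) = 0`).
[cite: GreenbergLNM1716, §1 p. 60, §2 pp. 62–63] -/
theorem natCard_torsionBy_selmerLayer_zero_two_eq_natCard_sha (hr : W.mordellWeilRank = 0) (κ : ZpExtension ℚ 2) :
    Nat.card ((↥(W.selmerLayer κ 0))[(2 : ℤ)]) = Nat.card ((↥W.sha)[(2 : ℤ)]) := by
  rw [natCard_torsionBy_selmerLayer_zero_two_eq_pow_rank_mul_sha W κ, hr, pow_zero, one_mul]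

omit [W.IsElliptic] [W.IsGloballyMinimal] in
/-- **On a seed, `rank E(ℚ) = 0`**: `BSDp W 2` records `rank E(ℚ) = r_an(W)` (Miller's Def. 1.1, first clause) and `r_an = 0`.
[cite: Miller2011LMS, Def. 1.1] -/
theorem mordellWeilRank_eq_zero_of_bsdp (hbsd : BSDp W 2) (hr : W.analyticRank = 0) : W.mordellWeilRank = 0 :=
  hbsd.1.trans hr

/-! ## §2 The base-layer door: ONE `2`-descent over `ℚ_k` against the known one over `ℚ` -/

/-- ★★★ **THE BASE-LAYER DOOR.** For every `W/ℚ` (globally minimal, elliptic) good ordinary at `2` WITHOUT a rational point of order `2`,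
the cyclotomic `ℤ₂`-extension `κ` with topological generator `γ`, ANY dual datum `D`, and ONE layer `k ≥ 1`: if
**`#Sel^(2)(E/ℚ_k) · #ker g_k · 2 < #Sel^(2)(E/ℚ) · 2^{2^k}`** (`Sel^(2)(E/ℚ_k) = selmerGroup (W.baseChange (κ.layer k)) 2`, the `2`-Selmer
group of a `2`-descent over `ℚ_k`; `Sel^(2)(E/ℚ) = W.selmerGroup 2`, the one over `ℚ`), then `X(W/ℚ_∞)` is `Λ`-torsion, `μ₂(X) = 0`, `X` is
finitely generated over `ℤ₂` and `2^{λ(X)} ≤ #Sel^(2)(E/ℚ_k) · #ker g_k` — the pair `(0, k)` of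
`…MuDoorDescent.seedMuZero_of_descent_rankJump_two` with the lower side read over `ℚ` (§1).
[cite: GreenbergLNM1716, §1 Conj. 1.11 and p. 60; §3 Lemmas 3.1–3.4] [cite: SilvermanAEC2009, Thm. X.4.2] [cite: Washington1997, §13.3 Prop. 13.23] -/
theorem seedMuZero_of_descent_baseJump_two (hord : IsOrdinaryAt W 2) (ht : ∀ x : ℚ, ¬ HasRationalTwoTorsionX W x)
    (κ : ZpExtension ℚ 2) (hκ : κ.IsCyclotomic) {γ : Field.absoluteGaloisGroup ℚ} (hγ : κ.IsTopGenerator γ)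
    (D : W.SelmerDualData κ γ) {k : ℕ} (hk : 0 < k)
    (hlt : Nat.card ((W.baseChange (κ.layer k)).selmerGroup 2) * Nat.card (W.KerG κ k) * 2 <
      Nat.card (W.selmerGroup 2) * 2 ^ (2 ^ k)) :
    D.IsTorsion ∧ D.mu = 0 ∧ Module.Finite ℤ_[2] (RestrictScalars ℤ_[2] (IwasawaAlgebra 2) D.X) ∧
      2 ^ D.lambda ≤ Nat.card ((W.baseChange (κ.layer k)).selmerGroup 2) * Nat.card (W.KerG κ k) := by
  rw [natCard_selmerGroup_two_layer_eq W ht κ k] at hlt ⊢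
  rw [natCard_selmerGroup_two_eq_natCard_torsionBy_selmerLayer_zero W ht κ] at hlt
  exact seedMuZero_of_selmer_rankJump_two W hord ht κ hκ hγ D hk (by simpa only [pow_zero, pow_one] using hlt)

/-- ★★★ **THE BASE-LAYER DOOR ON THE RANK-`0` CELL, Ш-form.** As `seedMuZero_of_descent_baseJump_two`, for a seed with `rank E(ℚ) = 0`
(`r_an = 0 ∧ BSD₂`, `mordellWeilRank_eq_zero_of_bsdp`): **`#Sel^(2)(E/ℚ_k) · #ker g_k · 2 < #Ш(E/ℚ)[2] · 2^{2^k}` ⟹ `X` torsion, `μ₂ = 0`,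
`2^{λ} ≤ #Sel^(2)(E/ℚ_k) · #ker g_k`** — the seed's own `Ш(E/ℚ)[2]` (certified by its BSD data) is the lower side of the door.
[cite: GreenbergLNM1716, §1 Conj. 1.11; §2 pp. 62–63; §3 Lemmas 3.1–3.4] [cite: SilvermanAEC2009, Thm. X.4.2] -/
theorem seedMuZero_of_descent_baseJump_sha_two (hord : IsOrdinaryAt W 2) (ht : ∀ x : ℚ, ¬ HasRationalTwoTorsionX W x)
    (hr : W.mordellWeilRank = 0)
    (κ : ZpExtension ℚ 2) (hκ : κ.IsCyclotomic) {γ : Field.absoluteGaloisGroup ℚ} (hγ : κ.IsTopGenerator γ)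
    (D : W.SelmerDualData κ γ) {k : ℕ} (hk : 0 < k)
    (hlt : Nat.card ((W.baseChange (κ.layer k)).selmerGroup 2) * Nat.card (W.KerG κ k) * 2 <
      Nat.card ((↥W.sha)[(2 : ℤ)]) * 2 ^ (2 ^ k)) :
    D.IsTorsion ∧ D.mu = 0 ∧ Module.Finite ℤ_[2] (RestrictScalars ℤ_[2] (IwasawaAlgebra 2) D.X) ∧
      2 ^ D.lambda ≤ Nat.card ((W.baseChange (κ.layer k)).selmerGroup 2) * Nat.card (W.KerG κ k) := by
  rw [natCard_selmerGroup_two_layer_eq W ht κ k] at hlt ⊢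
  rw [← natCard_torsionBy_selmerLayer_zero_two_eq_natCard_sha W hr κ] at hlt
  exact seedMuZero_of_selmer_rankJump_two W hord ht κ hκ hγ D hk (by simpa only [pow_zero, pow_one] using hlt)

/-- ★★ **ONE EXTRA BIT WHEN `2 ∣ #Ш_an`.** For a seed (`W/ℚ` globally minimal, good ordinary at `2`, no rational point of order `2`) with
`BSD₂(W)` and `#Ш_an(W) = q`, `ord₂ q ≠ 0` (so `#Ш(E/ℚ)[2] ≥ 4`: Cauchy in `Ш[2^∞]` + the Cassels–Tate alternating pairing, tree
`four_le_natCard_sha_torsionBy_two_of_bsdp`), the cyclotomic `κ` with topological generator `γ`, ANY dual datum, ONE layer `k ≥ 1`: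
**`#Sel^(2)(E/ℚ_k) · #ker g_k < 2^{2^k + 1}` ⟹ `X` torsion ∧ `μ₂ = 0`** (vs. `< 2^{2^k}` for the one-layer door). At `k = 2`:
`rk₂ Sel^(2)(E/ℚ(ζ₁₆)⁺) + log₂ #ker g_2 ≤ 4`. [cite: GreenbergLNM1716, §1 Conj. 1.11; §3 Lemmas 3.1–3.4] [cite: Cassels1962ArithmeticIV, Thm. 1.1]
[cite: Miller2011LMS, Def. 1.1] [cite: SilvermanAEC2009, Thm. X.4.2] -/
theorem seedMuZero_of_descent_baseJump_of_shaAn_even (hord : IsOrdinaryAt W 2) (ht : ∀ x : ℚ, ¬ HasRationalTwoTorsionX W x)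
    (hbsd : BSDp W 2) (hr : W.analyticRank = 0) {q : ℚ} (hq : shaAn W = (q : ℂ)) (hv : padicValRat 2 q ≠ 0)
    (κ : ZpExtension ℚ 2) (hκ : κ.IsCyclotomic) {γ : Field.absoluteGaloisGroup ℚ} (hγ : κ.IsTopGenerator γ)
    (D : W.SelmerDualData κ γ) {k : ℕ} (hk : 0 < k)
    (hlt : Nat.card ((W.baseChange (κ.layer k)).selmerGroup 2) * Nat.card (W.KerG κ k) < 2 ^ (2 ^ k + 1)) :
    D.IsTorsion ∧ D.mu = 0 := by
  have h4 : 4 ≤ Nat.card ((↥W.sha)[(2 : ℤ)]) := by exact_mod_cast four_le_natCard_sha_torsionBy_two_of_bsdp W hbsd hq hv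
  have h := seedMuZero_of_descent_baseJump_sha_two W hord ht (mordellWeilRank_eq_zero_of_bsdp W hbsd hr) κ hκ hγ D hk
    (by
      calc Nat.card ((W.baseChange (κ.layer k)).selmerGroup 2) * Nat.card (W.KerG κ k) * 2
          < 2 ^ (2 ^ k + 1) * 2 := by
            exact Nat.mul_lt_mul_of_lt_of_le hlt le_rfl (by norm_num)
        _ = 4 * 2 ^ (2 ^ k) := by ring
        _ ≤ Nat.card ((↥W.sha)[(2 : ℤ)]) * 2 ^ (2 ^ k) := Nat.mul_le_mul_right _ h4)
  exact ⟨h.1, h.2.1⟩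

end Summit.BirchSwinnertonDyer.BirchSwinnertonDyer.Theorems.AlignedTransportAtTwoSelmerLayerMuDoorDescentBase

end
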